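import Mathlib
import HarnessLib
import Literature.Computability.AlgebraicComplexity.NilCoxeterTensor
import Literature.Computability.AlgebraicComplexity.NilCoxeterRankTransfer
import Summits.MatrixMultiplication.MatrixMultiplication.Theses.NilCoxeterShadow

/-!
# Crux `AThesis` (stmt-MatrixMultiplication-0956) — `RankCloses.lean`: a closes-file for the RANK thesis

FOR THE TENURE PLANNER of route `NilCoxeterShadow` (lead prover of line `birth`, after the crux strategist's
`Lines/rank_gap.lean` / `STRATEGY-CENSUS.md`, 2026-08-17). The strategist's observation, now backed by the
Literature lemma `tensorRank_nilCoxeterTensor_le_pow_four_mul` (`Literature/…/NilCoxeterRankTransfer.lean`,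
landed by this seat): the Rees degeneration `ℂ[S_n] ⇝ NC_n` has POLYNOMIAL order `h = n(n−1)/2`, so
`R(T_{NC_n}) ≤ n⁴ · R(T_{ℂ[S_n]})`, and therefore the RANK thesis

  `RankThesis : ∃ δ > 0, ∀ n₀, ∃ n ≥ n₀, (n!)^(1+δ) ≤ R(T_{NC_n})`   (inlined tensor, route vocabulary)

— a CONSEQUENCE of the crux `AThesis` (`bR ≤ R`, `rankThesis_of_aThesis` below), conjecturally strictly
weaker — already refutes `ω(ℂ) = 2` together with the PROVED support `OmegaTwoGroupAlgebraRank` (stmt-0962):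
`closes_rank : RankThesis → OmegaTwoGroupAlgebraRank → ¬ MatrixMultiplication`, sorry-free, standard axioms,
importing only Mathlib / Literature / the route file — i.e. it has the shape of a `--closes-file` for a route
edit that adds `RankThesis` as an item (signature = the body of `RankThesis` below, verbatim) and re-points the
deciding theorem. Proof adapted from the strategist's `not_matrixMultiplication_of_superlinearRank`
(Cruxes/AThesis/Lines/rank_gap.lean), with the Theorems import replaced by the item hypothesis.

This file is a crux WORKFILE (it declares a `def`, so it is not proposed under Theorems/); nothing here is a stub
of line `birth`.
-/

-- `Summit.<Summit>.<Problem>`: for the single-conjunct summit the duplicate component is mandated.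
set_option linter.dupNamespace false

namespace Summit.MatrixMultiplication.MatrixMultiplication.Cruxes.AThesis.RankCloses

open Literature.Computability.AlgebraicComplexity
open Summit.MatrixMultiplication.MatrixMultiplication.Theses.NilCoxeterShadow

/-- **The RANK thesis** (proposed route item; the tensor inlined exactly as in the route file, `tensorRank` in
place of `algBorderRank`): `∃ δ > 0, ∀ n₀, ∃ n ≥ n₀, (n!)^(1+δ) ≤ R(T_{NC_n})`. -/
def RankThesis : Prop :=
  ∃ δ : ℝ, 0 < δ ∧ ∀ n₀ : ℕ, ∃ n : ℕ, n₀ ≤ n ∧ (n.factorial : ℝ) ^ (1 + δ) ≤ (Literature.Computability.AlgebraicComplexity.tensorRank (fun z x y : Equiv.Perm (Fin n) => if x * y = z ∧ (Finset.univ.filter (fun p : Fin n × Fin n => p.1 < p.2 ∧ z p.2 < z p.1)).card = (Finset.univ.filter (fun p : Fin n × Fin n => p.1 < p.2 ∧ x p.2 < x p.1)).card + (Finset.univ.filter (fun p : Fin n × Fin n => p.1 < p.2 ∧ y p.2 < y p.1)).card then (1 : ℂ) else 0) : ℝ)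

/-- `RankThesis` is the `nilCoxeterTensor` form by `rfl` (`nilCoxeterTensor_eq`). [folklore] -/
theorem rankThesis_iff : RankThesis ↔
    ∃ δ : ℝ, 0 < δ ∧ ∀ n₀ : ℕ, ∃ n : ℕ, n₀ ≤ n ∧
      (n.factorial : ℝ) ^ (1 + δ) ≤ (tensorRank (nilCoxeterTensor ℂ n) : ℝ) :=
  Iff.rfl

/-- **The crux implies the rank thesis** (`bR ≤ R`, `algBorderRank_le_tensorRank`); the converse is open.
[folklore] -/
theorem rankThesis_of_aThesis (h : AThesis) : RankThesis := by
  obtain ⟨δ, hδ, hio⟩ := h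
  refine ⟨δ, hδ, fun n₀ => ?_⟩
  obtain ⟨n, hn, hle⟩ := hio n₀
  refine ⟨n, hn, hle.trans ?_⟩
  have h := algBorderRank_le_tensorRank (nilCoxeterTensor ℂ n)
  rw [nilCoxeterTensor_eq] at h
  exact Nat.cast_le.mpr h

/-- `n^k ≤ 2^k · n!` for `n ≥ 2k` (from `(n+1−k)^k ≤ n!/(n−k)!`, Mathlib's `Nat.pow_sub_le_descFactorial`,
and `n ≤ 2(n+1−k)`). [folklore] -/
theorem pow_le_two_pow_mul_factorial {k n : ℕ} (h : 2 * k ≤ n) : n ^ k ≤ 2 ^ k * n.factorial := by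
  have hk : k ≤ n := by omega
  have h1 : n ≤ 2 * (n + 1 - k) := by omega
  have h2 : n.descFactorial k ≤ n.factorial := by
    rw [← Nat.factorial_mul_descFactorial hk]
    exact Nat.le_mul_of_pos_left _ (Nat.factorial_pos _)
  calc n ^ k ≤ (2 * (n + 1 - k)) ^ k := Nat.pow_le_pow_left h1 k
    _ = 2 ^ k * (n + 1 - k) ^ k := by rw [mul_pow]
    _ ≤ 2 ^ k * n.descFactorial k := Nat.mul_le_mul_left _ (Nat.pow_sub_le_descFactorial n k)
    _ ≤ 2 ^ k * n.factorial := Nat.mul_le_mul_left _ h2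

/-- **DECIDING THEOREM for the rank thesis** (closes-file shape): `RankThesis → OmegaTwoGroupAlgebraRank →
¬ MatrixMultiplication`. From `ω = 2`: `R(T_{ℂ[S_n]}) ≤ C·(n!)^{1+δ/2}` (item `OmegaTwoGroupAlgebraRank`,
`|S_n| = n!`), so `R(T_{NC_n}) ≤ n⁴·C·(n!)^{1+δ/2}` (`tensorRank_nilCoxeterTensor_le_pow_four_mul`); with the
rank thesis, `(n!)^{δ/2} ≤ C·n⁴` for infinitely many `n` — absurd, since `n⁵ ≤ 2^{kδ/2}·(n!)^{δ/2}` for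
`k ≥ 10/δ` and `n ≥ 2k` (`pow_le_two_pow_mul_factorial`). Adapted from the crux strategist's
`not_matrixMultiplication_of_superlinearRank`. [folklore] -/
theorem closes_rank (hR : RankThesis) (hO : OmegaTwoGroupAlgebraRank) : ¬ _root_.MatrixMultiplication := by
  intro hMM
  obtain ⟨δ, hδ, hio⟩ := rankThesis_iff.mp hR
  obtain ⟨C, hC⟩ := hO hMM (δ / 2) (half_pos hδ)
  -- an exponent `k` with `5 ≤ k·δ/2`
  obtain ⟨k, hk⟩ := exists_nat_ge (10 / δ)
  have hkδ : (5 : ℝ) ≤ (k : ℝ) * (δ / 2) := by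
    have : 10 / δ * (δ / 2) = 5 := by field_simp; ring
    rw [← this]
    exact mul_le_mul_of_nonneg_right hk (by positivity)
  set K : ℝ := ((2 : ℝ) ^ k) ^ (δ / 2) with hK
  have hKpos : 0 < K := Real.rpow_pos_of_pos (by positivity) _
  obtain ⟨N, hN⟩ := exists_nat_gt (K * max C 1)
  obtain ⟨n, hn, hRn⟩ := hio (max N (2 * k + 2))
  have hnN : N ≤ n := (le_max_left _ _).trans hn
  have hn2k : 2 * k ≤ n := by have := (le_max_right _ _).trans hn; omega
  have hn2 : 2 ≤ n := by have := (le_max_right _ _).trans hn; omega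
  have hnpos : (0 : ℝ) < n := by exact_mod_cast (show 0 < n by omega)
  have hn1 : (1 : ℝ) ≤ n := by exact_mod_cast (show 1 ≤ n by omega)
  have hfpos : (0 : ℝ) < (n.factorial : ℝ) := by exact_mod_cast n.factorial_pos
  -- (1) `R(T_{NC_n}) ≤ n⁴ · C · (n!)^{1+δ/2}`
  have hS := hC (Equiv.Perm (Fin n))
  rw [Fintype.card_perm, Fintype.card_fin] at hS
  have hT : (tensorRank (nilCoxeterTensor ℂ n) : ℝ) ≤
      (n : ℝ) ^ 4 * (C * (n.factorial : ℝ) ^ (1 + δ / 2)) := by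
    have h1 : (tensorRank (nilCoxeterTensor ℂ n) : ℝ) ≤
        ((n ^ 4 : ℕ) : ℝ) * (tensorRank (groupTensor ℂ (Equiv.Perm (Fin n))) : ℝ) := by
      exact_mod_cast tensorRank_nilCoxeterTensor_le_pow_four_mul ℂ hn2
    have h3 : (0 : ℝ) ≤ ((n ^ 4 : ℕ) : ℝ) := Nat.cast_nonneg _
    calc (tensorRank (nilCoxeterTensor ℂ n) : ℝ)
        ≤ ((n ^ 4 : ℕ) : ℝ) * (tensorRank (groupTensor ℂ (Equiv.Perm (Fin n))) : ℝ) := h1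
      _ ≤ ((n ^ 4 : ℕ) : ℝ) * (C * (n.factorial : ℝ) ^ (1 + δ / 2)) :=
          mul_le_mul_of_nonneg_left hS h3
      _ = (n : ℝ) ^ 4 * (C * (n.factorial : ℝ) ^ (1 + δ / 2)) := by push_cast; ring
  -- (2) hence `(n!)^{δ/2} ≤ n⁴ · C`
  have hmain : (n.factorial : ℝ) ^ (δ / 2) ≤ (n : ℝ) ^ 4 * C := by
    have h1 : (n.factorial : ℝ) ^ (δ / 2) * (n.factorial : ℝ) ^ (1 + δ / 2) ≤
        ((n : ℝ) ^ 4 * C) * (n.factorial : ℝ) ^ (1 + δ / 2) := by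
      calc (n.factorial : ℝ) ^ (δ / 2) * (n.factorial : ℝ) ^ (1 + δ / 2)
          = (n.factorial : ℝ) ^ (1 + δ) := by
            rw [← Real.rpow_add hfpos]
            congr 1
            ring
        _ ≤ (tensorRank (nilCoxeterTensor ℂ n) : ℝ) := hRn
        _ ≤ (n : ℝ) ^ 4 * (C * (n.factorial : ℝ) ^ (1 + δ / 2)) := hT
        _ = ((n : ℝ) ^ 4 * C) * (n.factorial : ℝ) ^ (1 + δ / 2) := by ring
    exact le_of_mul_le_mul_right h1 (Real.rpow_pos_of_pos hfpos _)
  -- (3) but `n⁵ ≤ K · (n!)^{δ/2}`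
  have hpoly : (n : ℝ) ^ 5 ≤ K * (n.factorial : ℝ) ^ (δ / 2) := by
    have h1 : ((n : ℝ) ^ k) ≤ (2 : ℝ) ^ k * (n.factorial : ℝ) := by
      exact_mod_cast pow_le_two_pow_mul_factorial hn2k
    have h2 : ((n : ℝ) ^ k) ^ (δ / 2) ≤ ((2 : ℝ) ^ k * (n.factorial : ℝ)) ^ (δ / 2) :=
      Real.rpow_le_rpow (by positivity) h1 (by positivity)
    rw [Real.mul_rpow (by positivity) hfpos.le] at h2
    have h3 : (n : ℝ) ^ 5 ≤ ((n : ℝ) ^ k) ^ (δ / 2) := by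
      rw [← Real.rpow_natCast (n : ℝ) k, ← Real.rpow_mul hnpos.le, ← Real.rpow_natCast (n : ℝ) 5]
      exact Real.rpow_le_rpow_of_exponent_le hn1 (by exact_mod_cast hkδ)
    exact h3.trans h2
  -- (4) combine: `n ≤ K · C < N ≤ n`
  have h4pos : (0 : ℝ) < (n : ℝ) ^ 4 := by positivity
  have hcomb : (n : ℝ) * (n : ℝ) ^ 4 ≤ (K * C) * (n : ℝ) ^ 4 := by
    calc (n : ℝ) * (n : ℝ) ^ 4 = (n : ℝ) ^ 5 := by ring
      _ ≤ K * (n.factorial : ℝ) ^ (δ / 2) := hpoly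
      _ ≤ K * ((n : ℝ) ^ 4 * C) := mul_le_mul_of_nonneg_left hmain hKpos.le
      _ = (K * C) * (n : ℝ) ^ 4 := by ring
  have hle : (n : ℝ) ≤ K * C := le_of_mul_le_mul_right hcomb h4pos
  have hKC : K * C ≤ K * max C 1 := mul_le_mul_of_nonneg_left (le_max_left _ _) hKpos.le
  have hNn : (N : ℝ) ≤ n := by exact_mod_cast hnN
  linarith

/-- The current deciding theorem factors through the rank thesis: `AThesis → OmegaTwoGroupAlgebraRank →
¬ MatrixMultiplication` WITHOUT `DegenerationTransfer` at the border level (the rank transfer replaces it).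
[folklore] -/
theorem closes_via_rank (hT : AThesis) (hO : OmegaTwoGroupAlgebraRank) : ¬ _root_.MatrixMultiplication :=
  closes_rank (rankThesis_of_aThesis hT) hO

end Summit.MatrixMultiplication.MatrixMultiplication.Cruxes.AThesis.RankCloses
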